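import Summits.Ventures.CertifiedArithmetic.LowPrec.GemmThetaE4M3E5M2Defs

/-!
# θ-certificate of E4M3·E5M2→bfloat16: the global tables, kernel-checked

HONEST FRAMING (venture CertifiedArithmetic / cell `pub-lowprec`, seat gemm, gen 9): certified error
envelopes and provably optimal rounding/accumulation schemes for low-precision formats under stated
cost models; every table by two implementations; no hardware or vendor claims.

Paper `gemm.tex` §Regimes Prop. Θ(i), instance E4M3·E5M2→`bfloat16`: the letter-independent part of the
compressed certificate of `GemmThetaE4M3E5M2Defs.lean`, by `decide +kernel` — the absorption windows of all
`2 · 6657` signed states (`statesOK`: two roundings each), the window chains (`winChainOK 1`, `2`), the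
value/potential chain (`monoChainOK`), the start checks of the 2085 letters with the letter count, and
the two saturation witnesses at `±2^58`.  Used by `GemmThetaE4M3E5M2Sound.lean`.
-/

namespace Literature.ComputerArithmetic.FloatingPoint

namespace MiniFloat

namespace ThetaE4M3E5M2

/-- Windows of the states `0..1109`. [cell certificate, kernel-checked] -/
theorem states_ok_0 : statesOK 0 1110 = true := by
  decide +kernel

/-- Windows of the states `1110..2219`. [cell certificate, kernel-checked] -/
theorem states_ok_1 : statesOK 1110 1110 = true := by
  decide +kernel

/-- Windows of the states `2220..3329`. [cell certificate, kernel-checked] -/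
theorem states_ok_2 : statesOK 2220 1110 = true := by
  decide +kernel

/-- Windows of the states `3330..4439`. [cell certificate, kernel-checked] -/
theorem states_ok_3 : statesOK 3330 1110 = true := by
  decide +kernel

/-- Windows of the states `4440..5549`. [cell certificate, kernel-checked] -/
theorem states_ok_4 : statesOK 4440 1110 = true := by
  decide +kernel

/-- Windows of the states `5550..6656`. [cell certificate, kernel-checked] -/
theorem states_ok_5 : statesOK 5550 1107 = true := by
  decide +kernel

/-- The window chains with step `1` (absorbed runs), lower half. [cell certificate, kernel-checked] -/
theorem winChain_one_lo : winChainOK 1 0 3329 = true := by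
  decide +kernel

/-- The window chains with step `1`, upper half. [cell certificate, kernel-checked] -/
theorem winChain_one_hi : winChainOK 1 3329 3328 = true := by
  decide +kernel

/-- The window chains with step `2` (parity classes), lower half. [cell certificate, kernel-checked] -/
theorem winChain_two_lo : winChainOK 2 0 3329 = true := by
  decide +kernel

/-- The window chains with step `2`, upper half. [cell certificate, kernel-checked] -/
theorem winChain_two_hi : winChainOK 2 3329 3328 = true := by
  decide +kernel

/-- `valG` strictly increasing, `Φ` nondecreasing along the indices `0..6656`. [cell certificate,
kernel-checked] -/
theorem monoChain_ok : monoChainOK 0 6656 = true := by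
  decide +kernel

/-- Every letter passes `startOK`, and there are `2085` letters. [cell certificate, kernel-checked] -/
theorem starts_len_ok : (lamG.all startOK && lamG.length == 2085) = true := by
  decide +kernel

/-- Saturation witness: the top state absorbs the largest letter upward. [cell, kernel-checked] -/
theorem rne8_top_add : rne8 (288230376151711744 + 862017116176384) = 288230376151711744 := by
  decide +kernel

/-- Saturation witness, negative side. [cell, kernel-checked] -/
theorem rne8_bot_sub : rne8 (-288230376151711744 - 862017116176384) = -288230376151711744 := by
  decide +kernel

end ThetaE4M3E5M2

end MiniFloat

end Literature.ComputerArithmetic.FloatingPoint
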